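import Summits.BirchSwinnertonDyer.BirchSwinnertonDyer.Theorems.SchneiderFreeAdditiveX3JointUpperManin
import Summits.BirchSwinnertonDyer.BirchSwinnertonDyer.Theorems.SchneiderFreeAdditiveX3GoodMemberStub
import Summits.BirchSwinnertonDyer.Rank1Residual.Additive.QuadraticTwistBSDComparisonIsogeny
import Summits.BirchSwinnertonDyer.Rank1Residual.Additive.GordIsogenyInvarianceClasses
import Summits.BirchSwinnertonDyer.Rank1Residual.Additive.N10LowerHalfStatements
import Literature.NumberTheory.EllipticCurves.IsogenyQuadraticTwistProofs
import Literature.NumberTheory.EllipticCurves.IsogenyCompProofs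
import Literature.NumberTheory.EllipticCurves.KrizLi2019.SexticTwistBSDThreeDescent
import Literature.NumberTheory.EllipticCurves.BSDHeegnerPointsGrossZagierProofs
import Literature.NumberTheory.EllipticCurves.GlobalMinimalModelProofs
import HarnessLib

/-!
# Schneider-free additive X3 door, SECOND WING on the (G-ord, `e = 2`) cell — the class-level assembly
# with the member juggling kernel-checked: co-socket at a GOOD member, twist unit at ANY member (Theses-free)

Cell `bsd-schneider-ideate`, seat `bsd-schneider-door-c5` (prover, generation 8); memo
`memos/ROUTE-P2-upper-v1-g13.md` (planner P2 gen 13) U14/U16: "pick `W₂` (unit twist) and a good member `W₁`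
over the SAME `K`; run the co-chain at `W₁` ⟹ co-STEP L at `W₁` ⟹ `JointUpperBoundAt W₁ W₁^{d_K}` (co-GZ) ⟹
`JointUpperBoundAt W₂ W₂^{d_K}` (Cassels twice) ⟹ `MissingUpperBoundAt W₂` (unit) ⟹ `MissingUpperBoundAt W`
(Cassels) … the member-juggling is glue". This file IS that glue, kernel-checked, with every analytic /
arithmetic input an explicit hypothesis in socket currency:

* §1 `jointUpperBoundAt_of_isIsogenous` — `Upper.JointUpperBoundAt` transports along `ℚ`-isogenies in BOTH
  arguments (Cassels `bsdRHS_eq_of_isIsogenous` + GZK finiteness in analytic rank `≤ 1`, via bsd-addord's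
  `TwistComparison.defectAgreeAt_of_isIsogenous`).
* §2 `missingUpperBoundAt_gordTwo_of_coIMC_of_control_of_twistUnitMember` — for `(W, p)` on the cell
  (`r_an = 1`, `p` odd, `ClassX3`, `SubGordTwo`): the UPPER half `MissingUpperBoundAt W p` from
  (facts) Gross–Zagier I.(6.3), Kolyvagin, GZK, modularity (entire continuation and a parametrisation datum),
  Gross–Zagier I.(7.3), Cassels, Heegner points over `K`;
  (`hCtl`) the control corner's conclusion `SchneiderFree.AdditiveControlInputManinAt` on the cell (items
  19295/19548, CLOSED modulo `ControlFacts`);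
  (`hCo`) the (G-ord, `e = 2`) co-socket `Upper.AdditiveIMCUpperBDPInputManinAt` at every KY-normalised
  curve of the cell (a rational `p`-line not fixed by `D_p`) — candidate exact type of the wing's crux
  `GordTwoBranchCoIMC` (memo U16; on this cell = Keller–Yin Thm. 3.5.1's Kolyvagin half + CH18, PRE/untyped);
  (`hTU`) a twist-unit member: some globally minimal `W₂ ~ W` with `Upper.TwistUnitHeegnerDataAt W₂ p` —
  candidate exact type of the wing's crux `TwistUnitX3` (memo U19; Vatsal/Kriz–Li type).
  The GOOD member `W₁` for the twist-unit datum's field `K` is door-c4 gen 7's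
  `GoodMember.exists_goodMember_of_modularParametrization` (in tree, modulo modularity); `W₁` lies on the
  cell (bsd-addord's isogeny invariance `Addv.of_isIsogenous_of_typeG`, `subGord_iff_of_isIsogenous`,
  `semistabilityIndex_eq_of_isIsogenous_of_typeG_of_addv`), has a Heegner point over `K` (fact) which is
  non-torsion by Gross–Zagier (`L(W₁^{d_K},1) = L(W₂^{d_K},1) ≠ 0`: twisting commutes with isogenies,
  `IsIsogenous.quadraticTwist`, and isogenous curves have equal `L`-functions); co-STEP L at `W₁` is
  `Upper.additiveCoStepLInputManinAt_of_kolyvagin_of_control_of_imcUpper`; co-GZ is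
  `Upper.jointUpperBoundAt_of_coStepL_manin`; the descent is `Upper.missingUpperBoundAt_of_jointUpper_of_twistUnit`;
  the two Cassels steps are §1 and `TwistComparison.missingUpperBoundAt_of_isIsogenous`.

HONEST FRAMING: CONDITIONAL on every displayed hypothesis (`hCo` is preprint-bound on this cell, `hTU` is a
per-pair certificate / unproved class-wide statement); no rung leaf is registered for the wing; closes no
item; BSD is not advanced. No named fact is used silently (all are binders).

References: [JetchevSkinnerWan2017] §7.4.1 (arXiv:1512.06894 p. 30); [GrossZagier1986] I.(6.3), (7.3);
[Miller2011LMS] §1, Def. 1.1 (BSD(E,p) is an isogeny invariant — Cassels); [Cassels1965ArithmeticVIII];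
[KellerYin2024b] arXiv:2410.23241 Thm. 3.5.1, §3.3 ¶1; [Vatsal1999] Thm. 0.3; [CremonaAlgorithms1997] §3.9.
-/

noncomputable section

open scoped Classical

open WeierstrassCurve NumberField IsDedekindDomain Field Literature.NumberTheory.EllipticCurves
  Literature.NumberTheory.EllipticCurves.ModularForms
  Literature.NumberTheory.EllipticCurves.GreenbergSelmer
  Literature.NumberTheory.EllipticCurves.Rank1Residual
  Literature.NumberTheory.EllipticCurves.Rank1Residual.Typed
  Literature.NumberTheory.GaloisRepresentations
  Literature.NumberTheory.EllipticCurves.KellerYin2024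
  Summit.BirchSwinnertonDyer.Rank1Residual
  Summit.BirchSwinnertonDyer.Rank1Residual.Additive
  Summit.BirchSwinnertonDyer.Rank1Residual.X11b
  Summit.BirchSwinnertonDyer.Rank1Residual.X11b.AcSelmer
  Summit.BirchSwinnertonDyer.Rank1Residual.X11b.Halves
  Summit.BirchSwinnertonDyer.BirchSwinnertonDyer.Theorems.SchneiderFree

set_option linter.dupNamespace false
set_option autoImplicit false

namespace Summit.BirchSwinnertonDyer.BirchSwinnertonDyer.Theorems.SchneiderFree.Upper

/-! ### §1 `JointUpperBoundAt` is an isogeny invariant in both arguments (Cassels) -/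

/-- **The JOINT upper half transports along `ℚ`-isogenies of both curves** (globally minimal models,
analytic ranks `≤ 1` so that `Ш` is finite by GZK): `ord_p #Ш_an − ord_p #Ш` is an isogeny invariant of
each factor separately (Cassels; bsd-addord's `TwistComparison.defectAgreeAt_of_isIsogenous`).
[cite: Miller2011LMS, §1 and Def. 1.1] [cite: Cassels1965ArithmeticVIII] -/
theorem jointUpperBoundAt_of_isIsogenous {W W' Wd Wd' : WeierstrassCurve ℚ} [W.IsElliptic]
    [W.IsGloballyMinimal] [W'.IsElliptic] [W'.IsGloballyMinimal] [Wd.IsElliptic] [Wd.IsGloballyMinimal]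
    [Wd'.IsElliptic] [Wd'.IsGloballyMinimal] {p : ℕ} [Fact p.Prime]
    (hCassels : bsdRHS_eq_of_isIsogenous) (hGZK : rank_eq_analyticRank_of_analyticRank_le_one)
    (hmod : hasEntireLFunction_rat) (hiso : IsIsogenous W W') (hisod : IsIsogenous Wd Wd')
    (hr : W.analyticRank ≤ 1) (hrd : Wd.analyticRank ≤ 1) (h : JointUpperBoundAt W Wd p) :
    JointUpperBoundAt W' Wd' p := by
  obtain ⟨q, qd, hq, hqd, hle⟩ := h
  have hfin : W.ShaFinite := (hGZK W hr).2
  have hfind : Wd.ShaFinite := (hGZK Wd hrd).2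
  obtain ⟨r, r', hr0, hr', hδ⟩ :=
    TwistComparison.defectAgreeAt_of_isIsogenous W W' p hCassels hmod hiso hfin hq
  obtain ⟨s, s', hs0, hs', hδd⟩ :=
    TwistComparison.defectAgreeAt_of_isIsogenous Wd Wd' p hCassels hmod hisod hfind hqd
  have hrq : r = q := by exact_mod_cast hr0.symm.trans hq
  have hsq : s = qd := by exact_mod_cast hs0.symm.trans hqd
  subst hrq hsq
  exact ⟨r', s', hr', hs', by omega⟩

/-! ### §2 The UPPER half on the (G-ord, `e = 2`) cell: co-socket at a good member, twist unit at any member -/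

/-- **The second wing on the (G-ord, `e = 2`) cell with the member juggling kernel-checked.** For `W/ℚ`
globally minimal with `r_an = 1`, `p` odd, `ClassX3 W p`, `SubGordTwo W p`: `MissingUpperBoundAt W p`
(`ord_p #Ш(E) ≤ ord_p #Ш(E)_an`) follows from the printed facts (Gross–Zagier I.(6.3), Kolyvagin, GZK,
modularity ×2, Gross–Zagier I.(7.3), Cassels, Heegner points over `K` — all binders), the control corner's
conclusion on the cell (`hCtl`), the (G-ord, `e = 2`) CO-SOCKET at every KY-normalised curve of the cell
(`hCo`: a rational `p`-line not fixed by `D_p`; the co-socket's own binders carry `r_an = 1`, the N10 locus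
and `E(K)[p] = 0`), and a TWIST-UNIT MEMBER (`hTU`: some globally minimal `W₂ ~ W` with a twist-unit Heegner
datum). Route: `K` := the datum's field (`p ∣ N` splits, `p ∤ d_K`); `W₁` := door-c4 gen 7's good member of
`W` for `K` (modularity pays `N_{W₁} = N`); `W₁` is on the cell with `r_an(W₁) = 1`; a Heegner point `P₁` of
`W₁` over `K` (fact) is non-torsion by Gross–Zagier since `L'(W₁,1) ≠ 0` and
`L(W₁^{d_K},1) = L(W₂^{d_K},1) ≠ 0` (isogenous twists); co-STEP L at `(W₁, K, P₁)` from `hCo`, `hCtl` and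
Kolyvagin; co-GZ ⟹ `JointUpperBoundAt W₁ W₁^{d_K}`; Cassels twice (§1) ⟹ `JointUpperBoundAt W₂ Wd₂`; the unit ⟹
`MissingUpperBoundAt W₂`; Cassels ⟹ `MissingUpperBoundAt W`. CONDITIONAL on every displayed hypothesis;
registers/closes nothing; BSD is not advanced.
[cite: JetchevSkinnerWan2017, §7.4.1 (arXiv:1512.06894 p. 30)] [cite: GrossZagier1986, Thm. I.(6.3)]
[cite: Miller2011LMS, §1 and Def. 1.1] [cite: KellerYin2024b, Thm. 3.5.1 and §3.3 ¶1 (arXiv:2410.23241) (shape of hCo; preprint)]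
[cite: Vatsal1999, Thm. 0.3 (shape of hTU)] [cite: CremonaAlgorithms1997, §3.9 (p. 87)] -/
theorem missingUpperBoundAt_gordTwo_of_coIMC_of_control_of_twistUnitMember
    (hGZ : ∀ (N : ℕ) [NeZero N] (W : WeierstrassCurve ℚ) (K : Type) [Field K] [NumberField K],
      gross_zagier N W K)
    (hKo : ∀ (N : ℕ) [NeZero N] (W : WeierstrassCurve ℚ) (K : Type) [Field K] [NumberField K],
      kolyvagin N W K)
    (hGZK : rank_eq_analyticRank_of_analyticRank_le_one) (hmod : hasEntireLFunction_rat)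
    (hPar : nonempty_modularParametrizationData) (hGZ73 : GrossZagier1986_thm_I_7_3)
    (hCassels : bsdRHS_eq_of_isIsogenous)
    (hHP : ∀ (W : WeierstrassCurve ℚ) (K : Type) [Field K] [NumberField K], exists_isHeegnerPoint W K)
    (hCtl : ∀ (W : WeierstrassCurve ℚ) [W.IsElliptic] [W.IsGloballyMinimal] (p : ℕ) [Fact p.Prime],
      W.analyticRank = 1 → p ≠ 2 → ClassX3 W p → Additive.SubSemistableTwist W p →
      AdditiveControlInputManinAt W p)
    (hCo : ∀ (W : WeierstrassCurve ℚ) [W.IsElliptic] [W.IsGloballyMinimal] (p : ℕ) [Fact p.Prime],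
      p ≠ 2 → ClassX3 W p → Additive.SubGordTwo W p →
      (∃ Φ : AddSubgroup (geomTorsion W (p : ℤ)), IsRationalLine W p Φ ∧ ¬ LineDecompositionTrivialAt W p Φ) →
      AdditiveIMCUpperBDPInputManinAt W p)
    (hTU : ∀ (W : WeierstrassCurve ℚ) [W.IsElliptic] [W.IsGloballyMinimal] (p : ℕ) [Fact p.Prime],
      W.analyticRank = 1 → p ≠ 2 → ClassX3 W p → Additive.SubGordTwo W p →
      ∃ (W₂ : WeierstrassCurve ℚ) (_ : W₂.IsElliptic) (_ : W₂.IsGloballyMinimal),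
        IsIsogenous W₂ W ∧ TwistUnitHeegnerDataAt W₂ p) :
    ∀ (W : WeierstrassCurve ℚ) [W.IsElliptic] [W.IsGloballyMinimal] (p : ℕ) [Fact p.Prime],
      W.analyticRank = 1 → p ≠ 2 → ClassX3 W p → Additive.SubGordTwo W p → MissingUpperBoundAt W p := by
  intro W _ _ p _ hr hp2 hX hS
  have hp : p.Prime := Fact.out
  -- the twist-unit member `W₂ ~ W` and its datum over `K`
  obtain ⟨W₂, hE₂, hmin₂, hiso₂, hT⟩ := hTU W p hr hp2 hX hS
  obtain ⟨N, _, K, _, _, Dt₂, H₂, ι₂, P₂, Wd₂, _, _, hN₂, hK, hodd, hw, hHH, hLd₂, hP₂, hnt₂, htf₂, hC₂,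
    hunit⟩ := hT
  -- conductors agree along the class (modularity), `p ∣ N` (additive), `p ∤ d_K` (Heegner: `p` splits)
  have hNW₂ : W₂.conductorNorm ℤ = W.conductorNorm ℤ :=
    GoodMember.conductorNorm_eq_of_isIsogenous_of_modularParametrization hPar W W₂ hiso₂
  have hNW : W.conductorNorm ℤ = N := hNW₂.symm.trans hN₂
  have hpNW : p ∣ W.conductorNorm ℤ := (W.dvd_conductorNorm_iff_not_hasGoodReductionAtPrime p).mpr hX.2.1
  have hpN : p ∣ N := hNW ▸ hpNW
  have hpd : ¬ (p : ℤ) ∣ NumberField.discr K :=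
    Literature.SatisfiesHeegnerHypothesis.not_dvd_discr hK.1 hHH hp hpN
  -- the GOOD member `W₁` of `W` for `K` (door-c4 gen 7; modularity pays the conductor clause)
  obtain ⟨W₁, hE₁, hmin₁, φ, m, -, -, hN₁, -, hred₁, hlat₁, htf₁⟩ :=
    GoodMember.exists_goodMember_of_modularParametrization hPar hp2 W hX hS K hK.1 hpd
  have hiso₁ : IsIsogenous W₁ W := ⟨φ⟩
  have hiso₁' : IsIsogenous W W₁ := hiso₁.symm_of_isElliptic
  -- `W₁` lies on the cell, with `r_an(W₁) = 1`
  have hG : TypeG W p := (subGord_iff_typeG_of_addv W p hp2 hX.2).mp hS.1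
  have hadd₁ : Addv W₁ p := Addv.of_isIsogenous_of_typeG hX.2 hG hiso₁'
  have hSG₁ : SubGord W₁ p := (subGord_iff_of_isIsogenous hp2 hX.2 hiso₁').mp hS.1
  have he₁ : semistabilityIndex W₁ p = 2 :=
    (semistabilityIndex_eq_of_isIsogenous_of_typeG_of_addv hp2 hX.2 hG hiso₁').trans hS.2
  have hX₁ : ClassX3 W₁ p := ⟨hred₁, hadd₁⟩
  have hS₁ : Additive.SubGordTwo W₁ p := ⟨hSG₁, he₁⟩
  have hr₁ : W₁.analyticRank = 1 := by rw [analyticRank_eq_of_isIsogenous' hiso₁, hr]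
  have hN₁' : W₁.conductorNorm ℤ = N := hN₁.trans hNW
  have hloc₁ : Additive.N10.Locus W₁ p :=
    (Additive.N10.locus_iff_cells W₁ p).mpr
      ((Additive.N10.cellM_or_cellGordTwo_of_classX3_of_subSemistableTwist W₁ p hp2 hX₁ (Or.inr hS₁)).elim
        Or.inl (fun h ↦ Or.inr (Or.inl h)))
  -- a Heegner point of `W₁` over `K` (fact), non-torsion by Gross–Zagier
  haveI : NeZero (W₁.conductorNorm ℤ) := ⟨W₁.conductorNorm_pos_holds.ne'⟩
  have hHH₁ : SatisfiesHeegnerHypothesis (W₁.conductorNorm ℤ) K := by rw [hN₁']; exact hHH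
  obtain ⟨P₁, Dt₁, H₁, ι₁, hP₁⟩ := hHP W₁ K hK hHH₁
  have hD0 : (NumberField.discr K : ℚ) ≠ 0 := by exact_mod_cast NumberField.discr_ne_zero K
  haveI hEt₁ : (W₁.quadraticTwist (NumberField.discr K : ℚ)).IsElliptic := W₁.isElliptic_quadraticTwist hD0
  haveI hEt₂ : (W₂.quadraticTwist (NumberField.discr K : ℚ)).IsElliptic := W₂.isElliptic_quadraticTwist hD0
  have hiso₁₂ : IsIsogenous W₁ W₂ := IsIsogenous.trans' hiso₁ hiso₂.symm_of_isElliptic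
  have hisot : IsIsogenous (W₁.quadraticTwist (NumberField.discr K : ℚ))
      (W₂.quadraticTwist (NumberField.discr K : ℚ)) := hiso₁₂.quadraticTwist hD0
  have hLd₁ : (W₁.quadraticTwist (NumberField.discr K : ℚ)).entireLFunction 1 ≠ 0 := by
    rw [entireLFunction_eq_of_isIsogenous' hisot]; exact hLd₂
  have hL0 : W₁.entireLFunction 1 = 0 := entireLFunction_one_eq_zero_of_analyticRank_eq_one hr₁
  obtain ⟨-, hderiv⟩ := leadingLCoeff_eq_deriv_of_analyticRank_eq_one hr₁
  have hLK : LDerivEK W₁ K ≠ 0 := by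
    rw [KrizLi2019.lDerivEK_eq_deriv_mul W₁ K hmod hL0]; exact mul_ne_zero hderiv hLd₁
  have hnt₁ : ¬ IsOfFinAddOrder P₁ :=
    (lDerivEK_ne_zero_iff_not_isOfFinAddOrder W₁ (W₁.conductorNorm ℤ) K (hGZ _ W₁ K) hK hHH₁
      ⟨Dt₁, H₁, ι₁, hP₁⟩).mp hLK
  -- co-STEP L at `(W₁, K, P₁)`: co-socket at the good member + control + Kolyvagin
  have hco : AdditiveCoStepLInputManinAt W₁ p :=
    additiveCoStepLInputManinAt_of_kolyvagin_of_control_of_imcUpper (fun N _ K _ _ ↦ hKo N W₁ K)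
      (hCtl W₁ p hr₁ hp2 hX₁ (Or.inr hS₁)) (hCo W₁ p hp2 hX₁ hS₁ hlat₁)
  have hI₁ : IndexUpperBoundLeAt W₁ p K P₁ (padicValNat p Dt₁.c.natAbs) :=
    hco (W₁.conductorNorm ℤ) K Dt₁ H₁ ι₁ P₁ hr₁ hloc₁ rfl hK hodd hw hHH₁ hLd₁ hP₁ hnt₁ htf₁
  -- a globally minimal model of `W₁^{(d_K)}` (analytic rank `0`) and co-GZ at `W₁`
  obtain ⟨Cd, hCd⟩ := hasGlobalMinimalModel_rat_holds (W₁.quadraticTwist (NumberField.discr K : ℚ))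
  set W₁d : WeierstrassCurve ℚ := Cd • W₁.quadraticTwist (NumberField.discr K : ℚ) with hW₁d_def
  haveI : W₁d.IsGloballyMinimal := hCd
  have hW₁d : Cd • W₁.quadraticTwist (NumberField.discr K : ℚ) = W₁d := rfl
  have hJ₁ : JointUpperBoundAt W₁ W₁d p :=
    jointUpperBoundAt_of_coStepL_manin hGZ hKo hGZK hmod hGZ73 W₁ p (W₁.conductorNorm ℤ) K Dt₁ H₁ ι₁ P₁
      W₁d hr₁ rfl (hN₁'.symm ▸ hpN) hK hodd hw hHH₁ hLd₁ hP₁ ⟨Cd, hW₁d⟩ hp2 hI₁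
  -- Cassels twice: `W₁ ~ W₂`, `W₁d ~ Wd₂` (twisting commutes with isogenies)
  obtain ⟨C₂, hWd₂⟩ := hC₂
  have hisod : IsIsogenous W₁d Wd₂ := by
    rw [← hW₁d, ← hWd₂]
    exact IsIsogenous.trans' (IsIsogenous.trans' (isIsogenous_of_smul _ Cd) hisot)
      (isIsogenous_smul _ C₂)
  have hrd : W₁d.analyticRank ≤ 1 := by
    have h0 : (W₁.quadraticTwist (NumberField.discr K : ℚ)).analyticRank = 0 :=
      ((W₁.quadraticTwist _).analyticRank_eq_zero_iff_holds (hmod _)).2 hLd₁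
    rw [← hW₁d, analyticRank_smul, h0]; exact zero_le_one
  have hJ₂ : JointUpperBoundAt W₂ Wd₂ p :=
    jointUpperBoundAt_of_isIsogenous hCassels hGZK hmod hiso₁₂ hisod hr₁.le hrd hJ₁
  -- the twist unit at `W₂`, then Cassels back to `W`
  have hU₂ : MissingUpperBoundAt W₂ p := missingUpperBoundAt_of_jointUpper_of_twistUnit hJ₂ hunit
  have hr₂ : W₂.analyticRank ≤ 1 := by rw [analyticRank_eq_of_isIsogenous' hiso₂, hr]
  exact TwistComparison.missingUpperBoundAt_of_isIsogenous W₂ W p hCassels hGZK hmod hiso₂ hr₂ hU₂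

end Summit.BirchSwinnertonDyer.BirchSwinnertonDyer.Theorems.SchneiderFree.Upper

end
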